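import Summits.Ventures.CertifiedManyBodySolver.Downfold.EmeryScaleLeverFIPath
import HarnessLib

/-!
# THE RAY LEAF AND THE VALUE LEAF OF THE SCALE COORDINATE: `t_node(θ + s·d, e + s·σ) ≤ (1 + s)·t_node(θ, e)` (resp. `≥ (1 − s)·…`) and
# `t_node(θ, e) ≤ U` (resp. `≥ L`) over fixed-point interval boxes — the arithmetic core of the TELESCOPED-EDGE / SCALING-RAY device (INFL-3to1-B §B.91)

Venture CertifiedManyBodySolver, cell `pub/hubbard-downfold` (stage S1; INFLATION-RULES-3to1-B §B.91), seat hubbard-downfold-mod-4 (technique B = band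
level, g40); namespace `Summit.Ventures.CertifiedManyBodySolver.Downfold.Emery`. Everything PROVED (0 sorry). WHAT THIS IS NOT: a statement about any
material; no number lives here; `U = 0` one-body kinematics of the σ model.

WHY. The corner-anchored chain of §B.88 (`EmeryScaleBoxChain`) moves `t_pd` by a contour-nesting lever whose pessimistic Fermi-energy rate (≈ 3 eV per eV of
`t_pd` on wide electron-doped boxes) exceeds the lever's slack, and moves `Δ` by a monotone step that fails where `T = t_node(θ; ε_F(θ; ν))` is nearly
flat in `Δ` (scale-g36 LESSON 16: the NCCO (K) source box). The successor device replaces the `t_pd` stage by the EXACT scaling law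
(`EmeryScalingLaw.fermiEnergyOf_smul`; `T(μθ) = μT(θ)`) plus ONE sub-homogeneity comparison along the oxygen-hopping ray `(t_pp, t_pp′) ↦ (1+s)(t_pp, t_pp′)`,
and replaces the `Δ` stage by point brackets telescoped along an edge plus a direct interval VALUE bound. This file supplies the two new kernel leaves:

* §1 **`rayLeaf upper …`** — the `pathLeaf` computation of `EmeryScaleLeverFIPath` (five rates, `fiPsi`) with the final test `Ψ ≤ 1` (`upper = true`) or
  `−1 ≤ Ψ` (`upper = false`) in place of the sign test; soundness **`scaleNode_le_mul_of_rayLeaf`** (`t′ ≤ (1 + s)·t`) and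
  **`scaleNode_ge_mul_of_rayLeaf`** (`(1 − s)·t ≤ t′`) from the ratio form `t′ = t(1 + sΨ)` (`scaleNode_move_ratio`).
* §2 **`valueLeaf upper … U`** — `N = F·P²`, `D = 2·E·G·Q` in FI and the cross-multiplied comparison with the scaled integer `U`; soundness
  **`scaleNode_div_le_of_valueLeaf`** (`N/D ≤ U/SC`) and **`le_scaleNode_div_of_valueLeaf`** (`U/SC ≤ N/D`).

Sources: three-band model [HybertsenSchluterChristensen1989, Eq. (1)]; energy-linearised one-band image [AndersenEtAl1995, §6]; interval arithmetic
[folklore] (Moore 1966).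
-/

noncomputable section

namespace Summit.Ventures.CertifiedManyBodySolver.Downfold.Emery

open Real Set Literature.Analysis.ValidatedNumerics.Numerics

/-! ## §1 The ray leaf -/

/-- **`rayLeaf upper …`** — kernel-decidable sufficient condition for `t_node(θ + s·d, e + s·σ) ≤ (1 + s)·t_node(θ, e)` (`upper = true`) or
`(1 − s)·t_node(θ, e) ≤ t_node(θ + s·d, e + s·σ)` (`upper = false`) uniformly over the input boxes (rows `θ = (Δ, a, b, c)`, energies `e`, move
`(dΔ, da, db, dc, σ)`, steps `s ≥ 0`): the ratio form `Ψ` of `pathLeaf` tested against `±1` instead of `0`. [folklore] -/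
def rayLeaf (upper : Bool) (ID IA IB IC IE IDD IDA IDB IDC ISG IS : FI) : Bool :=
  let E0 := fiE ID IE
  let G := fiG IA IB IE
  let P := fiP IA IB IC IE
  let Q := fiQ ID IA IB IC IE
  let F := fiF ID IA IB IC IE
  let dE := fidE IDD ISG
  let dG := fidG IA IB IE IDA IDB ISG IS
  let dP := fidP IA IB IC IE IDA IDB IDC ISG IS
  let dQ := fidQ ID IA IB IC IE IDD IDA IDB IDC ISG IS
  let dF := fidF ID IA IB IC IE IDD IDA IDB IDC ISG IS
  let E2 := E0.add (IS.mul dE)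
  let G2 := G.add (IS.mul dG)
  let Q2 := Q.add (IS.mul dQ)
  decide (0 ≤ IS.lo) && decide (0 < E0.lo) && decide (0 < G.lo) && decide (0 < Q.lo) && decide (0 < F.lo) && decide (0 < P.lo) &&
    decide (0 < E2.lo) && decide (0 < G2.lo) && decide (0 < Q2.lo) &&
  match FI.divPos dF F, FI.divPos dP P, FI.divPos dE.neg E2, FI.divPos dG.neg G2, FI.divPos dQ.neg Q2 with
  | some rF, some rP, some rE, some rG, some rQ =>
      if upper then decide ((fiPsi IS rF rP rE rG rQ).hi ≤ (SC : ℤ)) else decide (-(SC : ℤ) ≤ (fiPsi IS rF rP rE rG rQ).lo)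
  | _, _, _, _, _ => false

section Sound

variable {ID IA IB IC IE IDD IDA IDB IDC ISG IS : FI} {Δ a b c e dΔ da db dc σ s : ℝ}

/-- `Ψ·SC ≤ SC ⇒ Ψ ≤ 1`, read off an FI upper endpoint. [folklore] -/
theorem le_one_of_hi_le_SC {x : ℝ} {I : FI} (hx : FI.mem x I) (h : I.hi ≤ (SC : ℤ)) : x ≤ 1 := by
  have h' : (I.hi : ℝ) ≤ (SC : ℝ) := by exact_mod_cast h
  have := hx.2.trans h'
  nlinarith [SC_pos]

/-- `−SC ≤ Ψ·SC ⇒ −1 ≤ Ψ`, read off an FI lower endpoint. [folklore] -/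
theorem neg_one_le_of_neg_SC_le_lo {x : ℝ} {I : FI} (hx : FI.mem x I) (h : -(SC : ℤ) ≤ I.lo) : -1 ≤ x := by
  have h' : -(SC : ℝ) ≤ (I.lo : ℝ) := by exact_mod_cast h
  have := h'.trans hx.1
  nlinarith [SC_pos]

/-- The common part of the two soundness proofs: the ratio form and the `±1` tests. [folklore] -/
theorem rayLeaf_ratio {upper : Bool} (h : rayLeaf upper ID IA IB IC IE IDD IDA IDB IDC ISG IS = true) (hD : FI.mem Δ ID) (hA : FI.mem a IA)
    (hB : FI.mem b IB) (hC : FI.mem c IC) (hE : FI.mem e IE) (hDD : FI.mem dΔ IDD) (hDA : FI.mem da IDA) (hDB : FI.mem db IDB) (hDC : FI.mem dc IDC)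
    (hSG : FI.mem σ ISG) (hS : FI.mem s IS) :
    ∃ Ψ : ℝ, scaleNodeN (Δ + s * dΔ) (a + s * da) (b + s * db) (c + s * dc) (e + s * σ) / scaleNodeD (Δ + s * dΔ) (a + s * da) (b + s * db) (c + s * dc) (e + s * σ) =
        scaleNodeN Δ a b c e / scaleNodeD Δ a b c e * (1 + s * Ψ) ∧
      0 ≤ scaleNodeN Δ a b c e / scaleNodeD Δ a b c e ∧ 0 ≤ s ∧ (upper = true → Ψ ≤ 1) ∧ (upper = false → -1 ≤ Ψ) := by
  have mE0 := mem_fiE hD hE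
  have mG := mem_fiG hA hB hE
  have mP := mem_fiP hA hB hC hE
  have mQ := mem_fiQ hD hA hB hC hE
  have mF := mem_fiF hD hA hB hC hE
  have mdE := mem_fidE hDD hSG
  have mdG := mem_fidG hA hB hE hDA hDB hSG hS
  have mdP := mem_fidP hA hB hC hE hDA hDB hDC hSG hS
  have mdQ := mem_fidQ hD hA hB hC hE hDD hDA hDB hDC hSG hS
  have mdF := mem_fidF hD hA hB hC hE hDD hDA hDB hDC hSG hS
  have mE2 := FI.mem_add mE0 (FI.mem_mul hS mdE)
  have mG2 := FI.mem_add mG (FI.mem_mul hS mdG)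
  have mQ2 := FI.mem_add mQ (FI.mem_mul hS mdQ)
  unfold rayLeaf at h
  simp only [Bool.and_eq_true, decide_eq_true_eq] at h
  obtain ⟨⟨⟨⟨⟨⟨⟨⟨⟨hs0, hE0⟩, hG0⟩, hQ0⟩, hF0⟩, hP0⟩, hE2⟩, hG2⟩, hQ2⟩, hrest⟩ := h
  have Hs : 0 ≤ s := nonneg_of_lo_nonneg hS hs0
  have HE : 0 < snE Δ e := FI.pos_of_lo_pos mE0 hE0
  have HG : 0 < snG a b e := FI.pos_of_lo_pos mG hG0
  have HQ : 0 < snQ Δ a b c e := FI.pos_of_lo_pos mQ hQ0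
  have HF : 0 < snF Δ a b c e := FI.pos_of_lo_pos mF hF0
  have HP : 0 < snP a b c e := FI.pos_of_lo_pos mP hP0
  have HE2 : 0 < snE Δ e + s * dsnE dΔ σ := FI.pos_of_lo_pos mE2 hE2
  have HG2 : 0 < snG a b e + s * dsnG a b e da db σ s := FI.pos_of_lo_pos mG2 hG2
  have HQ2 : 0 < snQ Δ a b c e + s * dsnQ Δ a b c e dΔ da db dc σ s := FI.pos_of_lo_pos mQ2 hQ2
  split at hrest
  · rename_i rF rP rE rG rQ hrF hrP hrE hrG hrQ
    set F := snF Δ a b c e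
    set P := snP a b c e
    set E0 := snE Δ e
    set G := snG a b e
    set Q := snQ Δ a b c e
    set dF := dsnF Δ a b c e dΔ da db dc σ s
    set dP := dsnP a b c e da db dc σ s
    set dE := dsnE dΔ σ
    set dG := dsnG a b e da db σ s
    set dQ := dsnQ Δ a b c e dΔ da db dc σ s
    have mρF : FI.mem (dF / F) rF := FI.mem_divPos hrF mdF mF
    have mρP : FI.mem (dP / P) rP := FI.mem_divPos hrP mdP mP
    have mρE : FI.mem (-dE / (E0 + s * dE)) rE := FI.mem_divPos hrE (FI.mem_neg mdE) mE2
    have mρG : FI.mem (-dG / (G + s * dG)) rG := FI.mem_divPos hrG (FI.mem_neg mdG) mG2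
    have mρQ : FI.mem (-dQ / (Q + s * dQ)) rQ := FI.mem_divPos hrQ (FI.mem_neg mdQ) mQ2
    have mΨ := mem_fiPsi hS mρF mρP mρE mρG mρQ
    refine ⟨pathPsi s (dF / F) (dP / P) (-dE / (E0 + s * dE)) (-dG / (G + s * dG)) (-dQ / (Q + s * dQ)), ?_, ?_, Hs, ?_, ?_⟩
    · have key := scaleNode_move_ratio (s := s) (div_mul_cancel₀ dF HF.ne') (div_mul_cancel₀ dP HP.ne') (div_mul_cancel₀ (-dE) HE2.ne')
        (div_mul_cancel₀ (-dG) HG2.ne') (div_mul_cancel₀ (-dQ) HQ2.ne') (by positivity) (by positivity)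
      rw [scaleNodeN_eq_sn, scaleNodeD_eq_sn, scaleNodeN_eq_sn, scaleNodeD_eq_sn, snF_move, snP_move, snE_move, snG_move, snQ_move]
      exact key
    · rw [scaleNodeN_eq_sn, scaleNodeD_eq_sn]; positivity
    · intro hu
      rw [hu, if_pos rfl, decide_eq_true_eq] at hrest
      exact le_one_of_hi_le_SC mΨ hrest
    · intro hu
      rw [hu] at hrest
      simp only [Bool.false_eq_true, ↓reduceIte, decide_eq_true_eq] at hrest
      exact neg_one_le_of_neg_SC_le_lo mΨ hrest
  · exact absurd hrest Bool.false_ne_true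

/-- The factor form of the ratio identity: `t′ = t(1 + sΨ)`, `t ≥ 0`, `s ≥ 0`: `Ψ ≤ 1 ⇒ t′ ≤ (1 + s)t` and `−1 ≤ Ψ ⇒ (1 − s)t ≤ t′`. [folklore] -/
theorem le_mul_of_ratio_form {t t' s Ψ : ℝ} (h : t' = t * (1 + s * Ψ)) (ht : 0 ≤ t) (hs : 0 ≤ s) :
    (Ψ ≤ 1 → t' ≤ (1 + s) * t) ∧ (-1 ≤ Ψ → (1 - s) * t ≤ t') := by
  constructor
  · intro hΨ
    have : t * (s * Ψ) ≤ t * s := mul_le_mul_of_nonneg_left (by nlinarith) ht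
    rw [h]; nlinarith
  · intro hΨ
    have : t * (-s) ≤ t * (s * Ψ) := mul_le_mul_of_nonneg_left (by nlinarith) ht
    rw [h]; nlinarith

/-- **SOUNDNESS OF `rayLeaf true`**: `t_node(θ + s·d, e + s·σ) ≤ (1 + s)·t_node(θ, e)` for all reals in the boxes. [folklore] -/
theorem scaleNode_le_mul_of_rayLeaf (h : rayLeaf true ID IA IB IC IE IDD IDA IDB IDC ISG IS = true) (hD : FI.mem Δ ID) (hA : FI.mem a IA)
    (hB : FI.mem b IB) (hC : FI.mem c IC) (hE : FI.mem e IE) (hDD : FI.mem dΔ IDD) (hDA : FI.mem da IDA) (hDB : FI.mem db IDB) (hDC : FI.mem dc IDC)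
    (hSG : FI.mem σ ISG) (hS : FI.mem s IS) :
    scaleNodeN (Δ + s * dΔ) (a + s * da) (b + s * db) (c + s * dc) (e + s * σ) / scaleNodeD (Δ + s * dΔ) (a + s * da) (b + s * db) (c + s * dc) (e + s * σ) ≤
      (1 + s) * (scaleNodeN Δ a b c e / scaleNodeD Δ a b c e) := by
  obtain ⟨Ψ, hratio, ht, hs, hup, -⟩ := rayLeaf_ratio h hD hA hB hC hE hDD hDA hDB hDC hSG hS
  exact (le_mul_of_ratio_form hratio ht hs).1 (hup rfl)

/-- **SOUNDNESS OF `rayLeaf false`**: `(1 − s)·t_node(θ, e) ≤ t_node(θ + s·d, e + s·σ)` for all reals in the boxes. [folklore] -/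
theorem scaleNode_ge_mul_of_rayLeaf (h : rayLeaf false ID IA IB IC IE IDD IDA IDB IDC ISG IS = true) (hD : FI.mem Δ ID) (hA : FI.mem a IA)
    (hB : FI.mem b IB) (hC : FI.mem c IC) (hE : FI.mem e IE) (hDD : FI.mem dΔ IDD) (hDA : FI.mem da IDA) (hDB : FI.mem db IDB) (hDC : FI.mem dc IDC)
    (hSG : FI.mem σ ISG) (hS : FI.mem s IS) :
    (1 - s) * (scaleNodeN Δ a b c e / scaleNodeD Δ a b c e) ≤
      scaleNodeN (Δ + s * dΔ) (a + s * da) (b + s * db) (c + s * dc) (e + s * σ) / scaleNodeD (Δ + s * dΔ) (a + s * da) (b + s * db) (c + s * dc) (e + s * σ) := by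
  obtain ⟨Ψ, hratio, ht, hs, -, hlo⟩ := rayLeaf_ratio h hD hA hB hC hE hDD hDA hDB hDC hSG hS
  exact (le_mul_of_ratio_form hratio ht hs).2 (hlo rfl)

end Sound

/-! ## §2 The value leaf -/

/-- FI image of `scaleNodeN = F·P²`. [folklore] -/
def fiSNN (ID IA IB IC IE : FI) : FI := (fiF ID IA IB IC IE).mul (fiP IA IB IC IE).sqr

/-- FI image of `scaleNodeD = 2·E·G·Q`. [folklore] -/
def fiSND (ID IA IB IC IE : FI) : FI := (((fiE ID IE).mul (fiG IA IB IE)).mul (fiQ ID IA IB IC IE)).mulInt 2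

section Value

variable {ID IA IB IC IE : FI} {Δ a b c e : ℝ}

/-- Inclusion of `fiSNN`. [folklore] -/
theorem mem_fiSNN (hD : FI.mem Δ ID) (hA : FI.mem a IA) (hB : FI.mem b IB) (hC : FI.mem c IC) (hE : FI.mem e IE) :
    FI.mem (scaleNodeN Δ a b c e) (fiSNN ID IA IB IC IE) := by
  rw [scaleNodeN_eq_sn]
  exact FI.mem_mul (mem_fiF hD hA hB hC hE) (FI.mem_sqr (mem_fiP hA hB hC hE))

/-- Inclusion of `fiSND`. [folklore] -/
theorem mem_fiSND (hD : FI.mem Δ ID) (hA : FI.mem a IA) (hB : FI.mem b IB) (hC : FI.mem c IC) (hE : FI.mem e IE) :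
    FI.mem (scaleNodeD Δ a b c e) (fiSND ID IA IB IC IE) := by
  rw [scaleNodeD_eq_sn]
  have h := FI.mem_mulInt (FI.mem_mul (FI.mem_mul (mem_fiE hD hE) (mem_fiG hA hB hE)) (mem_fiQ hD hA hB hC hE)) 2
  exact mem_of_eq h (by push_cast; ring)

end Value

/-- **`valueLeaf upper … U`** — kernel-decidable sufficient condition for `N/D ≤ U/SC` (`upper = true`: `D.lo > 0`, `0 ≤ U`, `N.hi·SC ≤ U·D.lo`) or
`U/SC ≤ N/D` (`upper = false`: `D.lo > 0`, `0 ≤ U`, `U·D.hi ≤ N.lo·SC`) uniformly over the input boxes. [folklore] -/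
def valueLeaf (upper : Bool) (ID IA IB IC IE : FI) (U : ℤ) : Bool :=
  let N := fiSNN ID IA IB IC IE
  let D := fiSND ID IA IB IC IE
  decide (0 < D.lo) && decide (0 ≤ U) && (if upper then decide (N.hi * (SC : ℤ) ≤ U * D.lo) else decide (U * D.hi ≤ N.lo * (SC : ℤ)))

section ValueSound

variable {ID IA IB IC IE : FI} {U : ℤ} {Δ a b c e : ℝ}

/-- **SOUNDNESS OF `valueLeaf true`**: `N/D ≤ U/SC` for all reals in the boxes. [folklore] -/
theorem scaleNode_div_le_of_valueLeaf (h : valueLeaf true ID IA IB IC IE U = true) (hD : FI.mem Δ ID) (hA : FI.mem a IA) (hB : FI.mem b IB)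
    (hC : FI.mem c IC) (hE : FI.mem e IE) :
    scaleNodeN Δ a b c e / scaleNodeD Δ a b c e ≤ (U : ℝ) / SC := by
  have mN := mem_fiSNN hD hA hB hC hE
  have mDd := mem_fiSND hD hA hB hC hE
  unfold valueLeaf at h
  simp only [↓reduceIte, Bool.and_eq_true, decide_eq_true_eq] at h
  obtain ⟨⟨hD0, hU0⟩, hcmp⟩ := h
  have HD : 0 < scaleNodeD Δ a b c e := FI.pos_of_lo_pos mDd hD0
  have hU : (0 : ℝ) ≤ U := by exact_mod_cast hU0
  have hcmp' : ((fiSNN ID IA IB IC IE).hi : ℝ) * (SC : ℝ) ≤ (U : ℝ) * ((fiSND ID IA IB IC IE).lo : ℝ) := by exact_mod_cast hcmp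
  rw [div_le_div_iff₀ HD SC_pos]
  have h1 : scaleNodeN Δ a b c e * SC ≤ ((fiSNN ID IA IB IC IE).hi : ℝ) := mN.2
  have h2 : ((fiSND ID IA IB IC IE).lo : ℝ) ≤ scaleNodeD Δ a b c e * SC := mDd.1
  nlinarith [SC_pos, mul_le_mul_of_nonneg_left h2 hU]

/-- **SOUNDNESS OF `valueLeaf false`**: `U/SC ≤ N/D` for all reals in the boxes. [folklore] -/
theorem le_scaleNode_div_of_valueLeaf (h : valueLeaf false ID IA IB IC IE U = true) (hD : FI.mem Δ ID) (hA : FI.mem a IA) (hB : FI.mem b IB)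
    (hC : FI.mem c IC) (hE : FI.mem e IE) :
    (U : ℝ) / SC ≤ scaleNodeN Δ a b c e / scaleNodeD Δ a b c e := by
  have mN := mem_fiSNN hD hA hB hC hE
  have mDd := mem_fiSND hD hA hB hC hE
  unfold valueLeaf at h
  simp only [Bool.false_eq_true, ↓reduceIte, Bool.and_eq_true, decide_eq_true_eq] at h
  obtain ⟨⟨hD0, hU0⟩, hcmp⟩ := h
  have HD : 0 < scaleNodeD Δ a b c e := FI.pos_of_lo_pos mDd hD0
  have hU : (0 : ℝ) ≤ U := by exact_mod_cast hU0
  have hcmp' : (U : ℝ) * ((fiSND ID IA IB IC IE).hi : ℝ) ≤ ((fiSNN ID IA IB IC IE).lo : ℝ) * (SC : ℝ) := by exact_mod_cast hcmp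
  rw [div_le_div_iff₀ SC_pos HD]
  have h1 : ((fiSNN ID IA IB IC IE).lo : ℝ) ≤ scaleNodeN Δ a b c e * SC := mN.1
  have h2 : scaleNodeD Δ a b c e * SC ≤ ((fiSND ID IA IB IC IE).hi : ℝ) := mDd.2
  nlinarith [SC_pos, mul_le_mul_of_nonneg_left h2 hU]

end ValueSound

end Summit.Ventures.CertifiedManyBodySolver.Downfold.Emery
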